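import Mathlib
import HarnessLib
import Literature.Analysis.FluidPDE.RieszPressureModConst

/-!
# Route `PoloidalWindowDoor`, crux `PoloidalWindowRigidity` (stmt-19708), line `sparse_energy` (cstrat g11) —
# stub S1, FILE C (discharge of the window pressure split), piece C1: THE RIESZ PRESSURE MODULO CONSTANTS AT CUT-OFF SCALE `R`

Seat ns-poloidal-K2-p2 g9 (successor of the interim LEAD-of-record on 19708; file `--supports`).  The `Mod` twin of the tree's
`PressureRepresentation.pressurePotential_eq_scale`: for a BOUNDED `C²` field `v` the Riesz pressure modulo constants
`pressurePotentialMod x₀ v = −Q₁^{1,2}[v] − farPotentialMod 1 2 x₀ v` (ns-es-p1's `Literature/Analysis/FluidPDE/RieszPressureModConst`) equals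
`−Q₁^{R,2R}[v] − farPotentialMod R 2R x₀ v` up to the ADDITIVE CONSTANT `∫ D²Ψ(x₀ − y)(v y, v y) dy`, `Ψ = Γ∞^{1,2} − Γ∞^{R,2R}` (smooth, compactly
supported): the near kernels differ by `−Ψ`, on which the two integrations by parts (`integral_comp_sub_mul_pressureSource`) are exact, and the far
kernels differ by `D²Ψ`; only the renormalisation at `x₀` survives.  This lets the local pressure split of S1's near-apex bootstrap put the
near/far cut at the window scale.

WHAT THIS IS NOT: not a claim about Navier–Stokes; potential theory of bounded fields (bears_on LADDER-NS N0 via crux 19708, line sparse_energy, stub S1). [folklore]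
-/

noncomputable section

-- the summit and its single sub-problem share the name (CONVENTIONS §1), as in every Theorems file
set_option linter.dupNamespace false

namespace Summit.NavierStokesRegularity.NavierStokesRegularity.Theorems.PoloidalWindowDoorPoloidalWindowRigiditySparseEnergyPressureScale

-- nested operator types `ℝ³ →L[ℝ] ℝ³ →L[ℝ] ℝ³ →L[ℝ] ℝ`
set_option maxSynthPendingDepth 3

open MeasureTheory Set Function Filter Topology Metric
open Literature.Analysis Literature.Analysis.FluidPDE

/-- The kernel difference `Ψ = Γ∞^{1,2} − Γ∞^{R,2R}` is `C²` with compact support (it vanishes for `‖z‖ ≥ max 2 (2R)`). [folklore] -/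
theorem kernelDiff_contDiff_hasCompactSupport {R : ℝ} (hR : 0 < R) :
    ContDiff ℝ 2 (fun z : EuclideanSpace ℝ (Fin 3) => newtonFar 1 2 z - newtonFar (R * 1) (R * 2) z) ∧
      HasCompactSupport (fun z : EuclideanSpace ℝ (Fin 3) => newtonFar 1 2 z - newtonFar (R * 1) (R * 2) z) := by
  have hR1 : 0 < R * 1 := by linarith
  have hR2 : R * 1 < R * 2 := by linarith
  refine ⟨(contDiff_newtonFar one_pos one_lt_two).sub (contDiff_newtonFar hR1 hR2), ?_⟩
  refine HasCompactSupport.intro (isCompact_closedBall (0 : EuclideanSpace ℝ (Fin 3)) (max 2 (R * 2))) fun z hz => ?_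
  rw [mem_closedBall_zero_iff, not_le, max_lt_iff] at hz
  show newtonFar 1 2 z - newtonFar (R * 1) (R * 2) z = 0
  rw [newtonFar_eq_newtonKernel zero_le_one one_lt_two hz.1.le, newtonFar_eq_newtonKernel hR1.le hR2 hz.2.le, sub_self]

/-- **`pressurePotentialMod` AT CUT-OFF SCALE `R` (explicit constant).**  For `R > 0`, a bounded `C²` field `v` and every base point `x₀`:
`pressurePotentialMod x₀ v x = −Q₁^{R,2R}[v](x) − farPotentialMod R 2R x₀ v x + ∫ D²Ψ(x₀ − y)(v y, v y) dy` at every `x`,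
`Ψ = Γ∞^{1,2} − Γ∞^{R,2R}`. [folklore] -/
theorem pressurePotentialMod_eq_scale {R : ℝ} (hR : 0 < R) {v : EuclideanSpace ℝ (Fin 3) → EuclideanSpace ℝ (Fin 3)}
    (hv : ContDiff ℝ 2 v) {N : ℝ} (hN : ∀ y, ‖v y‖ ≤ N) (x₀ x : EuclideanSpace ℝ (Fin 3)) :
    pressurePotentialMod x₀ v x = -nearPotential (R * 1) (R * 2) v x - farPotentialMod (R * 1) (R * 2) x₀ v x +
      ∫ y, fderiv ℝ (fderiv ℝ (fun z : EuclideanSpace ℝ (Fin 3) => newtonFar 1 2 z - newtonFar (R * 1) (R * 2) z)) (x₀ - y) (v y) (v y) := by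
  have hR1 : 0 < R * 1 := by linarith
  have hR2 : R * 1 < R * 2 := by linarith
  set Ψ : EuclideanSpace ℝ (Fin 3) → ℝ := fun z => newtonFar 1 2 z - newtonFar (R * 1) (R * 2) z with hΨ
  obtain ⟨hΨs, hΨc⟩ := kernelDiff_contDiff_hasCompactSupport hR
  have hvc : Continuous v := hv.continuous
  -- the `D²Ψ`-integrand is continuous with compact support, hence integrable, at every base point
  have hD2c : Continuous (fderiv ℝ (fderiv ℝ Ψ)) :=
    ((hΨs.fderiv_right (m := 1) le_rfl).fderiv_right (m := 0) le_rfl).continuous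
  have hD2cs : HasCompactSupport (fderiv ℝ (fderiv ℝ Ψ)) := (hΨc.fderiv (𝕜 := ℝ)).fderiv (𝕜 := ℝ)
  have hint : ∀ x₁ : EuclideanSpace ℝ (Fin 3), Integrable fun y => fderiv ℝ (fderiv ℝ Ψ) (x₁ - y) (v y) (v y) := by
    intro x₁
    have hc : Continuous fun y => fderiv ℝ (fderiv ℝ Ψ) (x₁ - y) (v y) (v y) := by
      have h1 : Continuous fun y => fderiv ℝ (fderiv ℝ Ψ) (x₁ - y) := hD2c.comp (continuous_const.sub continuous_id)
      exact ((h1.clm_apply hvc).clm_apply hvc)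
    refine hc.integrable_of_hasCompactSupport ?_
    have hcs : HasCompactSupport fun y => fderiv ℝ (fderiv ℝ Ψ) (x₁ - y) := hD2cs.comp_homeomorph (Homeomorph.subLeft x₁)
    refine hcs.mono ?_
    intro y hy
    rw [mem_support] at hy ⊢
    contrapose! hy
    rw [hy]; simp
  -- (1) the near potentials differ by `∫ Ψ(z) G(x - z) dz`
  have h1 : nearPotential (R * 1) (R * 2) v x - nearPotential 1 2 v x = ∫ z, Ψ z * pressureSource v (x - z) := by
    rw [nearPotential, nearPotential, ← integral_sub (integrable_nearPotential_integrand hR1.le hR2 hv x)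
      (integrable_nearPotential_integrand zero_le_one one_lt_two hv x)]
    refine integral_congr_ae (Eventually.of_forall fun z => ?_)
    simp only [hΨ]
    rw [← sub_mul, newtonNear_sub_newtonNear]
  -- (2) double integration by parts on the compactly supported smooth `Ψ`
  have h2 : ∫ z, Ψ z * pressureSource v (x - z) = ∫ y, fderiv ℝ (fderiv ℝ Ψ) (x - y) (v y) (v y) := by
    rw [← integral_sub_left_eq_self (fun z => Ψ z * pressureSource v (x - z)) volume x]
    simp only [sub_sub_cancel]
    exact integral_comp_sub_mul_pressureSource hΨs hΨc hv x
  -- (3) the renormalised far potentials differ by `∫ D²Ψ(x - y)(v,v) - ∫ D²Ψ(x₀ - y)(v,v)`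
  have h3 : farPotentialMod 1 2 x₀ v x - farPotentialMod (R * 1) (R * 2) x₀ v x =
      (∫ y, fderiv ℝ (fderiv ℝ Ψ) (x - y) (v y) (v y)) - ∫ y, fderiv ℝ (fderiv ℝ Ψ) (x₀ - y) (v y) (v y) := by
    unfold farPotentialMod
    rw [← integral_sub (integrable_farPotentialMod_integrand one_pos one_lt_two hvc hN x₀ x)
      (integrable_farPotentialMod_integrand hR1 hR2 hvc hN x₀ x), ← integral_sub (hint x) (hint x₀)]
    refine integral_congr_ae (Eventually.of_forall fun y => ?_)
    simp only [hΨ]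
    rw [fderiv2_sub (contDiff_newtonFar one_pos one_lt_two) (contDiff_newtonFar hR1 hR2),
      fderiv2_sub (contDiff_newtonFar one_pos one_lt_two) (contDiff_newtonFar hR1 hR2)]
    simp only [sub_apply]
    ring
  rw [pressurePotentialMod]
  linarith [h1, h2, h3]

/-- **`pressurePotentialMod` AT CUT-OFF SCALE `R`, modulo a constant.**  For `R > 0`, a bounded `C²` field `v` and every base point `x₀` there is
`c ∈ ℝ` with `pressurePotentialMod x₀ v x = −Q₁^{R,2R}[v](x) − farPotentialMod R 2R x₀ v x + c` for all `x`. [folklore] -/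
theorem exists_pressurePotentialMod_eq_scale_add_const {R : ℝ} (hR : 0 < R) {v : EuclideanSpace ℝ (Fin 3) → EuclideanSpace ℝ (Fin 3)}
    (hv : ContDiff ℝ 2 v) {N : ℝ} (hN : ∀ y, ‖v y‖ ≤ N) (x₀ : EuclideanSpace ℝ (Fin 3)) :
    ∃ c : ℝ, ∀ x, pressurePotentialMod x₀ v x = -nearPotential (R * 1) (R * 2) v x - farPotentialMod (R * 1) (R * 2) x₀ v x + c :=
  ⟨_, fun x => pressurePotentialMod_eq_scale hR hv hN x₀ x⟩

end Summit.NavierStokesRegularity.NavierStokesRegularity.Theorems.PoloidalWindowDoorPoloidalWindowRigiditySparseEnergyPressureScale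

end
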